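import Summits.KontsevichZagierPeriods.KontsevichZagierPeriods.Theorems.EllipticMomentKernel.Negative.GeneralCurve
import Literature.NumberTheory.Transcendental.KZLogCalculusProofs

/-!
# `EllipticMomentKernel` (stmt-KontsevichZagierPeriods-10631), line `merge-first-single-hermite`:
# stub `stub_sigmaRep`

The CARRIER representations `[σ, A(x) + B(x)/√f(x)]` (`A, B ∈ ℚ[X]`,
`σ = oval q₂ q₃ = (e₃, e₂)`, `f = cubic q₂ q₃ = 4x³ − q₂x − q₃`, `disc > 0`) exist as honest
`KZ.IntegralRep 1`:

* the domain `σ` is `ℚ`-semialgebraic (`isSemialgebraic_oval`);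
* the integrand is `ℚ`-semialgebraic on `σ`: `A(p 0)` is the evaluation of the `MvPolynomial`
  `A(X 0)`, and `B(p 0)/√f = B(p 0) · √(1/f)` on `σ` (where `f > 0`), a product of a polynomial
  and the square root of a quotient of polynomials (`isSemialgebraicFunOn_aeval_div_aeval`,
  `sqrt_holds`, `mul_holds`, `add_holds`);
* the integrand is integrable on `σ`: `A` is continuous on the compact `[e₃, e₂] ⊇ σ`, and
  `B/√f` is a `ℚ`-combination of the `x^m/√f ∈ L¹(σ)` of `integrableOn_genIntegrandQ_oval`.
-/

noncomputable section

open MeasureTheory Set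
open scoped Polynomial

namespace Summit.KontsevichZagierPeriods.HermiteRigidity.EllipticMomentKernel

open Literature.NumberTheory.Transcendental
open Literature.NumberTheory.Transcendental.KZ
open Summit.KontsevichZagierPeriods.HermiteRigidity.EllipticMomentKernelNegative
open Summit.KontsevichZagierPeriods.KontsevichZagierPeriods.Theses.HermiteRigidity
  (EllipticMomentKernel HermiteExactFormVanishes)

/-- The polynomial part `p ↦ A(p 0)` of a carrier is `ℚ`-semialgebraic on `σ`: it is the evaluation
of the `MvPolynomial` `A(X 0)`. [cite: BochnakCosteRoy1998, Prop. 2.2.6] -/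
theorem sigmaRep_isSemialgebraicFunOn_aeval {q₂ q₃ : ℚ} (hΔ : 0 < disc q₂ q₃) (A : ℚ[X]) :
    IsSemialgebraicFunOn ℚ (oval q₂ q₃) (fun p => (Polynomial.aeval (p 0) A : ℝ)) := by
  have h := isSemialgebraicFunOn_aeval (isSemialgebraic_oval hΔ)
    (Polynomial.aeval (MvPolynomial.X 0 : MvPolynomial (Fin 1) ℚ) A)
  refine h.congr fun p _ => ?_
  simp only
  rw [← Polynomial.aeval_algHom_apply, MvPolynomial.aeval_X]

/-- The elliptic part `p ↦ B(p 0)/√f(p 0)` of a carrier is `ℚ`-semialgebraic on `σ`: on `σ` one has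
`f > 0`, so `B/√f = B · √(1/f)`, a polynomial times the square root of a quotient of polynomials
with non-vanishing denominator. [cite: BochnakCosteRoy1998, Prop. 2.2.6] -/
theorem sigmaRep_isSemialgebraicFunOn_aeval_div_sqrt {q₂ q₃ : ℚ} (hΔ : 0 < disc q₂ q₃)
    (B : ℚ[X]) :
    IsSemialgebraicFunOn ℚ (oval q₂ q₃)
      (fun p => (Polynomial.aeval (p 0) B : ℝ) / Real.sqrt (cubic q₂ q₃ (p 0))) := by
  have hs := isSemialgebraic_oval hΔ
  have h1 := sigmaRep_isSemialgebraicFunOn_aeval hΔ B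
  have h2 : IsSemialgebraicFunOn ℚ (oval q₂ q₃)
      (fun p => MvPolynomial.aeval p (1 : MvPolynomial (Fin 1) ℚ) /
        MvPolynomial.aeval p (cubicPolyQ q₂ q₃)) :=
    isSemialgebraicFunOn_aeval_div_aeval hs _ _ fun p hp => by
      rw [aeval_cubicPolyQ]; exact hp.1.ne'
  have h4 := IsSemialgebraicFunOn.mul_holds h1 (IsSemialgebraicFunOn.sqrt_holds h2)
  refine h4.congr fun p hp => ?_
  simp only [Pi.mul_apply, map_one, aeval_cubicPolyQ]
  rw [Real.sqrt_div' _ hp.1.le, Real.sqrt_one, mul_one_div]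

/-- The carrier integrand `p ↦ A(p 0) + B(p 0)/√f(p 0)` is `ℚ`-semialgebraic on `σ`.
[cite: BochnakCosteRoy1998, Prop. 2.2.6] -/
theorem sigmaRep_isSemialgebraicFunOn {q₂ q₃ : ℚ} (hΔ : 0 < disc q₂ q₃) (A B : ℚ[X]) :
    IsSemialgebraicFunOn ℚ (oval q₂ q₃) (fun p => (Polynomial.aeval (p 0) A : ℝ) +
      (Polynomial.aeval (p 0) B : ℝ) / Real.sqrt (cubic q₂ q₃ (p 0))) :=
  (IsSemialgebraicFunOn.add_holds (sigmaRep_isSemialgebraicFunOn_aeval hΔ A)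
    (sigmaRep_isSemialgebraicFunOn_aeval_div_sqrt hΔ B)).congr fun _ _ => rfl

/-- The polynomial part `p ↦ A(p 0)` is integrable on `σ = (e₃, e₂)`: a polynomial function is
continuous, hence integrable on the compact interval `[e₃, e₂]`, and `σ ⊆ ℝ¹` is the preimage of
`(e₃, e₂)` under the measure-preserving `e1 : ℝ¹ ≃ᵐ ℝ`. [folklore] -/
theorem sigmaRep_integrableOn_aeval {q₂ q₃ : ℚ} (hΔ : 0 < disc q₂ q₃) (A : ℚ[X]) :
    IntegrableOn (fun p : Fin 1 → ℝ => (Polynomial.aeval (p 0) A : ℝ)) (oval q₂ q₃) := by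
  obtain ⟨e₃, e₂, e₁, h3, h2a, h2b, h1, hf⟩ := exists_roots hΔ
  have h32 : e₃ < e₂ := by linarith
  have h21 : e₂ < e₁ := by linarith
  have hset : oval q₂ q₃ = e1 ⁻¹' Ioo e₃ e₂ := by
    rw [oval_eq_of_roots h32 h21 hf]; ext p; simp
  rw [hset]
  have hI : IntegrableOn (fun x : ℝ => (Polynomial.aeval x A : ℝ)) (Ioo e₃ e₂) :=
    ((Polynomial.continuous_aeval A).integrableOn_Icc).mono_set Ioo_subset_Icc_self
  exact (measurePreserving_e1.integrableOn_comp_preimage e1.measurableEmbedding).mpr hI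

/-- The elliptic part `p ↦ B(p 0)/√f(p 0)` is integrable on `σ`: by additivity and
`B(x) = Σ bₘ xᵐ` it is a `ℚ`-combination of the integrable `x^m/√f`
(`integrableOn_genIntegrandQ_oval`). [folklore] -/
theorem sigmaRep_integrableOn_aeval_div_sqrt {q₂ q₃ : ℚ} (hΔ : 0 < disc q₂ q₃) (B : ℚ[X]) :
    IntegrableOn (fun p : Fin 1 → ℝ =>
      (Polynomial.aeval (p 0) B : ℝ) / Real.sqrt (cubic q₂ q₃ (p 0))) (oval q₂ q₃) := by
  induction B using Polynomial.induction_on' with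
  | add P Q hP hQ =>
    have heq : (fun p : Fin 1 → ℝ =>
        (Polynomial.aeval (p 0) (P + Q) : ℝ) / Real.sqrt (cubic q₂ q₃ (p 0))) =
        (fun p : Fin 1 → ℝ => (Polynomial.aeval (p 0) P : ℝ) / Real.sqrt (cubic q₂ q₃ (p 0))) +
          fun p : Fin 1 → ℝ => (Polynomial.aeval (p 0) Q : ℝ) / Real.sqrt (cubic q₂ q₃ (p 0)) := by
      funext p
      simp only [map_add, Pi.add_apply, add_div]
    rw [heq]
    exact hP.add hQ
  | monomial n a =>
    have heq : (fun p : Fin 1 → ℝ =>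
        (Polynomial.aeval (p 0) (Polynomial.monomial n a) : ℝ) / Real.sqrt (cubic q₂ q₃ (p 0))) =
        fun p : Fin 1 → ℝ => (a : ℝ) * (p 0 ^ n / Real.sqrt (cubic q₂ q₃ (p 0))) := by
      funext p
      rw [Polynomial.aeval_monomial, eq_ratCast, mul_div_assoc]
    rw [heq]
    exact (integrableOn_genIntegrandQ_oval hΔ n).const_mul _

/-- The carrier integrand `p ↦ A(p 0) + B(p 0)/√f(p 0)` is integrable on `σ`. [folklore] -/
theorem sigmaRep_integrableOn {q₂ q₃ : ℚ} (hΔ : 0 < disc q₂ q₃) (A B : ℚ[X]) :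
    IntegrableOn (fun p : Fin 1 → ℝ => (Polynomial.aeval (p 0) A : ℝ) +
      (Polynomial.aeval (p 0) B : ℝ) / Real.sqrt (cubic q₂ q₃ (p 0))) (oval q₂ q₃) :=
  (sigmaRep_integrableOn_aeval hΔ A).fun_add (sigmaRep_integrableOn_aeval_div_sqrt hΔ B)

/-- **Stub `stub_sigmaRep`**: the CARRIER representations exist — for all `A, B ∈ ℚ[X]` and
every admissible curve (`disc > 0`), `[σ, A(x) + B(x)/√f(x)]` is a KZ integral representation with
domain literally `oval q₂ q₃` and integrand literally `p ↦ A(p 0) + B(p 0)/√(cubic q₂ q₃ (p 0))`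
(domain `ℚ`-semialgebraic by `isSemialgebraic_oval`; integrand `ℚ`-semialgebraic — polynomial plus
polynomial times `√(1/f)`; integrable — `A` is continuous on the compact closure of the bounded `σ`,
`B/√f` is a `ℚ`-combination of the `x^m/√f ∈ L¹(σ)`). [cite: KontsevichZagier2001, §1.1] -/
theorem stub_sigmaRep (q₂ q₃ : ℚ) (hΔ : 0 < disc q₂ q₃) (A B : ℚ[X]) :
    ∃ s : IntegralRep 1, s.domain = oval q₂ q₃ ∧
      s.integrand = fun p => (Polynomial.aeval (p 0) A : ℝ) +
        (Polynomial.aeval (p 0) B : ℝ) / Real.sqrt (cubic q₂ q₃ (p 0)) :=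
  ⟨{ domain := oval q₂ q₃
     integrand := fun p => (Polynomial.aeval (p 0) A : ℝ) +
        (Polynomial.aeval (p 0) B : ℝ) / Real.sqrt (cubic q₂ q₃ (p 0))
     isSemialgebraic_domain := isSemialgebraic_oval hΔ
     isSemialgebraicFunOn_integrand := sigmaRep_isSemialgebraicFunOn hΔ A B
     integrableOn := sigmaRep_integrableOn hΔ A B }, rfl, rfl⟩

end Summit.KontsevichZagierPeriods.HermiteRigidity.EllipticMomentKernel
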